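import Summits.QuantumFields.BalabanUV.Beta.D1BFx.DressedVertex2Split
import Summits.QuantumFields.BalabanUV.Beta.D1BFx.ColumnGaugeGenerator
import Summits.QuantumFields.BalabanUV.Beta.SymCorrectorPairGauge

/-!
# `BalabanUV.Beta.D1BFx.ColumnGaugeSecondOrder` — road «BF-x» for binder row D1, slot (K), PART 24 FILE 2 (H2), brick TT15 part 2∕2: **THE COLUMN-SIDE SECOND-ORDER
# SLOT-SHIFT LETTER — under the slot Ward letters the three corrections of the dressed bi-vertex split are the OWNER's `Wmix`-pieces and `Wgg`-piece for the COLUMN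
# rotation generators `Λ^{μ,y} = diagK (ξ·χ_{μ,y} ∘ legSite ρ)`** (the column twin of leaf-03 g30's face-side TT11∕TT12 `SymCorrectorPairGauge(Vertex)`; the second-order twin of
# the OWNER d1-p2 g23's `ColumnGaugeGenerator` ∕ `ColumnGaugeNativeFirstOrder`)

HONEST DEPENDENCY (cell records, verbatim): «continuum YM on T⁴ ⇐ BetaPertH ∧ nine spine estimates (0/9 proved); BetaPertH ⇐ (D1) ∧ (D4) ∧
CAP+tail; G-an2-4 gates asym, D1 and NE2/3/4.»  HONEST FRAMING (cell contract, verbatim): «discharging `BetaPertH` makes Bałaban's UV stability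
UNCONDITIONAL — a real constructive-QFT result; it is NOT the continuum limit and NOT the Clay problem.»  THIS MODULE is [folklore] bookkeeping BY NAME
over part 1∕2 `DressedVertex2Split` (the analytic four-term split and its divergence sockets), the OWNER's `ColumnGaugeGenerator` (`wsum_conjV_diagK_legInd`,
`wsum_divV_eq_conjV_of_letters_smul`), leaf-03 g30's TT11 `SymCorrectorPairGauge` (`vertexOfK_conjV_diagK_fixed`, `divV_conjV_diagK_fixed`, `smul_conjV_diagK'`), an2's
`diagK`∕`conjV`, an1's `legInd`∕`legSite`.  The slot Ward letters `hL ∕ hR ∕ hT` (TT12's set, verbatim shapes; `hT₂` the second-slot partner's variant) are HYPOTHESES — which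
tables obey them, through which `K`, at which pins and with which scalars is the OWNER's FILE 2 ∕ instance, NOT claimed here.  No `def`, no `def … : Prop`, nothing cited, NO printed
hypothesis, 0 sorry.  0 root-level binders of row D1 discharged (hW ∕ hR-sockets ∕ hSX-socket ∕ D1Tel ∕ D1Rep = 0); (K) NOT closed; (J1) ONE OPEN ROW; NOT D1, NEVER «G-an2-4 closed»,
NOT `BetaPertH`, NOT continuum, NOT Clay.

ABSOLUTE RULE (cell charter, verbatim): «No internally-minted statement may enter as a cited fact. Every hypothesis is either kernel-proved in
this package or a verbatim quotation of a PUBLISHED theorem with page reference. The manuscript(s) under audit are NOT citable for their own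
disputed steps — they are the thing under adjudication; programme-internal (2001/route/tribunal) claims are never citable.»

THE MATHEMATICS (notation of part 1∕2: `K′ := coDressKBmAt ρ N K`, `χ := bmGaugeAt ρ (colH K N μ y) N`, `χ′ := bmGaugeAt ρ (colH K N ν y′) N`, `A κ u := vertexOfK K N (S₂ κ u) ν y′`,
`B κ u := wsum χ′ (divV (S₂ κ u))`; letters `hL : divV (κ u ↦ S₂ κ u κ′ u′) w = ξ₁ • conjV (T′ κ′ u′) (diagK (legInd ρ w))` (first slot, partner `T′`), `hR : divV (S₂ α x) w′ =
ξ₂ • conjV (T α x) (diagK (legInd ρ w′))` (second slot, partner `T`), `hT : divV T′ w′ = ξ₃ • conjV 𝕄 (diagK (legInd ρ w′))`; `Λᵢ[χ] := diagK (z b ↦ ξᵢ·χ (legSite ρ z b))`,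
`V_T := vertexOfK K N T`).
* §1 [folklore] diagonal-contact bookkeeping (no letters, no summability — every site sum is a one- or two-point sum): the superposed generator with a lock
  (`wsum_conjV_diagK_legInd_smul`), the two generators of an iterated contact commute (`conjV_conjV_diagK_comm`), superposition in the inner generator
  (`wsum_conjV_conjV_diagK_legInd_inner`), the `Wgg` sign bookkeeping `conjV (conjV 𝕄 Λ′) Λ = Λ∘G′ − G′∘Λ`, `G′ := Λ′∘𝕄 − 𝕄∘Λ′` (`conjV_conjV_diagK_eq_comm_G`).
* §2 [folklore] the three corrections under the letters: (i) `B κ u = conjV (T κ u) Λ₂[χ′]` and `vertexOfK K N B μ y = conjV (V_T μ y) Λ₂[χ′]` (`hR`; no summability);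
  (1) `divV A w = ξ₁ • conjV (V_{T′} ν y′) (diagK (legInd ρ w))` (leaf-03's (1); `hL`) and (ii) `wsum χ (divV A) = conjV (V_{T′} ν y′) Λ₁[χ]`; (iii) `wsum χ (divV B) = conjV (conjV 𝕄 Λ₃[χ′]) Λ₁[χ]`
  (`hL` + `hT`, NO Jacobi: the divergence-slot commutation of part 1∕2) and (iii′) `= conjV (conjV 𝕄 Λ₃[χ]) Λ₂[χ′]` under `hR` + `hT₂ : divV T w = ξ₃ • conjV 𝕄 (diagK (legInd ρ w))` instead.
* §3 ASSEMBLED: (2) `vertexOfK K′ N (S₂ κ u) ν y′ = A κ u − conjV (T κ u) Λ₂[χ′]` (leaf-03's (2)); (3) **`vertex2OfK K′ N S₂ μ y ν y′ = vertex2OfK K N S₂ μ y ν y′ − conjV (V_T μ y) Λ₂[χ′]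
  − conjV (V_{T′} ν y′) Λ₁[χ] + conjV (conjV 𝕄 Λ₃[χ′]) Λ₁[χ]`** (`vertex2OfK_coDressKBmAt_eq_of_letters`; primed variant with `hT₂`, leaf-03's (3) placement); (3′) the OWNER's
  orientation **`= vertex2OfK K N S₂ μ y ν y′ + (((Λ₂[χ′]∘V_T μ y − V_T μ y∘Λ₂[χ′]) + (Λ₁[χ]∘V_{T′} ν y′ − V_{T′} ν y′∘Λ₁[χ])) + (Λ₁[χ]∘G₃ − G₃∘Λ₁[χ]))`**, `G₃ := Λ₃[χ′]∘𝕄 − 𝕄∘Λ₃[χ′]`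
  (`vertex2OfK_coDressKBmAt_eq_add_Wmix_Wgg`) — LITERALLY the `(Wmix + Wgg)` bracket of `ColumnGaugeInvariance.hessKer_columnGauge` at `V μ y := V_T μ y`, `V ν y′ := V_{T′} ν y′`,
  `G ν y′ := G₃`; §4 for ONE table `T = T′ = S` and one lock `ξ` the bracket with ONE generator family `Λ` — the same `Λ` as the first order (`…_one`).
NOT in this file: the mixed word `mixOfK K′ …` and the response word of `W2OfK` (leaf-03's TT16 ∕ the OWNER's `Nr`); the instance (which tables, pins, scalars).
Unit `b2b-balaban-beta-d1-formalise-leaf-01` (gen 31), D1 formalisation swarm LEAF PROVER 01, road «BF-x»; statement list adopted from leaf-03 g30's INTENT-5 (journal), moved here by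
first refusal.  Not in print; our bookkeeping.  No existing file touched.
-/

noncomputable section

namespace Summit.QuantumFields.BalabanUV.Beta.D1BFx.ColumnGaugeSecondOrder

open Finset
open scoped BigOperators
open Literature.MathematicalPhysics.QuantumFieldTheory
open Literature.MathematicalPhysics.QuantumFieldTheory.LatticeForm (quo)
open Literature.MathematicalPhysics.QuantumFieldTheory.Balaban1983to89
open Literature.MathematicalPhysics.QuantumFieldTheory.Balaban1983to89.Beta
open B4ContourShift (supNorm)
open ExpKernelCalculus (MKer Decays comp)
open KernelWard (divV)
open AffineAveraging (Site box toSite)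
open OneStepResolventKernel (Fib wsum)
open OneStepKernelFamily (colH vertexOfK)
open BalabanCompositeJets (LocStencil₂)
open SecondOrderResponse (vertex2OfK)
open Summit.QuantumFields.BalabanUV.Beta.ChartConjugation (conjV)
open Summit.QuantumFields.BalabanUV.Beta.BorderedHessian (diagK conjV_diagK_apply comp_diagK_left comp_diagK_right)
open Summit.QuantumFields.BalabanUV.Beta.AveragingWardRootedStencils (legSite legInd)
open Summit.QuantumFields.BalabanUV.Beta.AxialDressingRooted (coDressKBmAt)
open Summit.QuantumFields.BalabanUV.Beta.AxialProjectorBlockMean (bmGaugeAt)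
open Summit.QuantumFields.BalabanUV.Beta.SecondOrderRemainderTables (abs_le_of_locStencil₂)
open Summit.QuantumFields.BalabanUV.Beta.D1BFx.ColumnGaugeGenerator (wsum_conjV_diagK_legInd wsum_divV_eq_conjV_of_letters_smul)
open Summit.QuantumFields.BalabanUV.Beta.SymCorrectorPairGauge (vertexOfK_conjV_diagK_fixed divV_conjV_diagK_fixed smul_conjV_diagK')
open Summit.QuantumFields.BalabanUV.Beta.D1BFx.DressedVertex2Split (summable_abs_bmGaugeAt vertexOfK_coDress_slice_eq_sub vertex2OfK_coDressKBmAt_eq_four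
  divV_sliceVertex_eq divV_wsum_divV_slice_eq)

variable {d : ℕ}

/-! ## §1 Diagonal-contact bookkeeping (no letters, no summability: every site sum is a one- or two-point sum) -/

/-- [folklore] **SUPERPOSED GENERATOR WITH A SCALAR**: `wsum χ (u ↦ conjV M (diagK (ξ·legInd ρ u))) = conjV M (diagK (z b ↦ ξ·χ (legSite ρ z b)))` (the OWNER's `wsum_conjV_diagK_legInd`
with the lock `ξ` carried in the symbol). -/
theorem wsum_conjV_diagK_legInd_smul (M : MKer (d + 1) (Fib d)) (χ : Site (d + 1) → ℝ) (ρ : Site (d + 1)) (ξ : ℝ) :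
    wsum χ (fun u => conjV M (diagK fun z b => ξ * legInd ρ u z b)) = conjV M (diagK fun z b => ξ * χ (legSite ρ z b)) := by
  have h1 : (fun u => conjV M (diagK fun z b => ξ * legInd ρ u z b)) = fun u => ξ • conjV M (diagK (legInd ρ u)) := by
    funext u; rw [smul_conjV_diagK']
  have h2 : wsum χ (fun u => ξ • conjV M (diagK (legInd ρ u))) = wsum (fun u => ξ * χ u) (fun u => conjV M (diagK (legInd ρ u))) := by
    funext x z a b
    simp only [OneStepResolventKernel.wsum, Pi.smul_apply, smul_eq_mul]
    exact tsum_congr fun u => by ring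
  rw [h1, h2]
  exact wsum_conjV_diagK_legInd M (fun u => ξ * χ u) ρ

/-- [folklore] **THE TWO GENERATORS OF AN ITERATED DIAGONAL CONTACT COMMUTE**: `conjV (conjV M (diagK g)) (diagK h) = conjV (conjV M (diagK h)) (diagK g)`
(entrywise `M x z a b·(g z b − g x a)·(h z b − h x a)`). -/
theorem conjV_conjV_diagK_comm (M : MKer (d + 1) (Fib d)) (g h : Site (d + 1) → Fib d → ℝ) :
    conjV (conjV M (diagK g)) (diagK h) = conjV (conjV M (diagK h)) (diagK g) := by
  funext x z a b
  simp only [conjV_diagK_apply]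
  ring

/-- [folklore] **SUPERPOSITION IN THE INNER GENERATOR** of an iterated contact: `wsum χ (u ↦ conjV (conjV M (diagK (ξ·legInd ρ u))) (diagK h)) = conjV (conjV M (diagK (ξ·χ∘legSite ρ))) (diagK h)`. -/
theorem wsum_conjV_conjV_diagK_legInd_inner (M : MKer (d + 1) (Fib d)) (χ : Site (d + 1) → ℝ) (ρ : Site (d + 1)) (ξ : ℝ) (h : Site (d + 1) → Fib d → ℝ) :
    wsum χ (fun u => conjV (conjV M (diagK fun z b => ξ * legInd ρ u z b)) (diagK h))
      = conjV (conjV M (diagK fun z b => ξ * χ (legSite ρ z b))) (diagK h) := by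
  have e : (fun u => conjV (conjV M (diagK fun z b => ξ * legInd ρ u z b)) (diagK h))
      = fun u => conjV (conjV M (diagK h)) (diagK fun z b => ξ * legInd ρ u z b) :=
    funext fun u => conjV_conjV_diagK_comm M _ h
  rw [e, wsum_conjV_diagK_legInd_smul, conjV_conjV_diagK_comm]

/-- [folklore] Sign bookkeeping for the `Wgg`-piece: `conjV (conjV 𝕄 Λ′) Λ = Λ∘G′ − G′∘Λ` with `G′ := Λ′∘𝕄 − 𝕄∘Λ′`, for diagonal `Λ`, `Λ′` (entrywise). -/
theorem conjV_conjV_diagK_eq_comm_G (𝕄 : MKer (d + 1) (Fib d)) (g g' : Site (d + 1) → Fib d → ℝ) :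
    conjV (conjV 𝕄 (diagK g')) (diagK g)
      = comp (diagK g) (comp (diagK g') 𝕄 - comp 𝕄 (diagK g')) - comp (comp (diagK g') 𝕄 - comp 𝕄 (diagK g')) (diagK g) := by
  funext x z a b
  simp only [Pi.sub_apply, conjV_diagK_apply, comp_diagK_left, comp_diagK_right]
  ring

/-! ## §2 The three corrections under the letters -/

section Letters

variable {N : ℕ} {K : MKer (d + 1) (Fib d)}
  {S₂ : Fin (d + 1) → Site (d + 1) → Fin (d + 1) → Site (d + 1) → MKer (d + 1) (Fib d)}
  {T T' : Fin (d + 1) → Site (d + 1) → MKer (d + 1) (Fib d)} {𝕄 : MKer (d + 1) (Fib d)} {ρ : Site (d + 1)} {ξ₁ ξ₂ ξ₃ : ℝ}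
  (hL : ∀ κ' u' w, divV (fun κ u => S₂ κ u κ' u') w = ξ₁ • conjV (T' κ' u') (diagK (legInd ρ w)))
  (hR : ∀ α x w', divV (S₂ α x) w' = ξ₂ • conjV (T α x) (diagK (legInd ρ w')))
  (hT : ∀ w', divV T' w' = ξ₃ • conjV 𝕄 (diagK (legInd ρ w')))
include hR in
/-- [folklore] **(i) THE GAUGE CORRECTION OF A SLICE IS A CONTACT OF THE SECOND-SLOT PARTNER**: under `hR`, for every weight `χ′`,
`wsum χ′ (divV (S₂ κ u)) = conjV (T κ u) (diagK (z b ↦ ξ₂·χ′ (legSite ρ z b)))` (the OWNER's `wsum_divV_eq_conjV_of_letters_smul` on the slice). -/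
theorem wsum_divV_slice_eq_of_letter (χ' : Site (d + 1) → ℝ) (κ : Fin (d + 1)) (u : Site (d + 1)) :
    wsum χ' (divV (S₂ κ u)) = conjV (T κ u) (diagK fun z b => ξ₂ * χ' (legSite ρ z b)) :=
  wsum_divV_eq_conjV_of_letters_smul (hR κ u) χ'

include hR in
/-- [folklore] **(i′) ITS OUTER VERTEX IS A CONTACT OF `V_T`**: under `hR`, for ANY `K` and weight `χ′` (no summability: TT11's fixed-generator linearity),
`vertexOfK K N (κ u ↦ wsum χ′ (divV (S₂ κ u))) μ y = conjV (vertexOfK K N T μ y) (diagK (z b ↦ ξ₂·χ′ (legSite ρ z b)))` — the column twin of TT12's «inner contact». -/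
theorem vertexOfK_wsum_divV_slice_eq_of_letter (χ' : Site (d + 1) → ℝ) (μ : Fin (d + 1)) (y : Site (d + 1)) :
    vertexOfK K N (fun κ u => wsum χ' (divV (S₂ κ u))) μ y = conjV (vertexOfK K N T μ y) (diagK fun z b => ξ₂ * χ' (legSite ρ z b)) := by
  have e : (fun κ u => wsum χ' (divV (S₂ κ u))) = fun κ u => conjV (T κ u) (diagK fun z b => ξ₂ * χ' (legSite ρ z b)) :=
    funext fun κ => funext fun u => wsum_divV_slice_eq_of_letter hR χ' κ u
  rw [e, vertexOfK_conjV_diagK_fixed]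

include hL in
/-- [folklore] **(1) THE INNER-VERTEX FAMILY OBEYS A FIRST-ORDER LETTER** (leaf-03's (1)): under `hL`, for a decaying `K` and an entrywise bounded `S₂`,
`divV (κ u ↦ vertexOfK K N (S₂ κ u) ν y′) w = ξ₁ • conjV (vertexOfK K N T′ ν y′) (diagK (legInd ρ w))`. -/
theorem divV_sliceVertex_eq_of_letter (hK : ∃ δ C : ℝ, 0 < δ ∧ 0 ≤ C ∧ Decays K C δ) {B₂ : ℝ} (hB : ∀ κ u κ' u' x z a b, |S₂ κ u κ' u' x z a b| ≤ B₂)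
    (ν : Fin (d + 1)) (y' : Site (d + 1)) (w : Site (d + 1)) :
    divV (fun κ u => vertexOfK K N (S₂ κ u) ν y') w = ξ₁ • conjV (vertexOfK K N T' ν y') (diagK (legInd ρ w)) := by
  rw [divV_sliceVertex_eq hK hB ν y' w]
  have e : (fun κ' u' => divV (fun κ u => S₂ κ u κ' u') w) = fun κ' u' => conjV (T' κ' u') (diagK fun z b => ξ₁ * legInd ρ w z b) := by
    funext κ' u'; rw [hL κ' u' w, smul_conjV_diagK']
  rw [e, vertexOfK_conjV_diagK_fixed, smul_conjV_diagK']

include hL in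
/-- [folklore] **(ii) THE OUTER GAUGE CORRECTION OF THE INNER-VERTEX FAMILY IS A CONTACT OF `V_{T′}`**: under `hL`, decaying `K`, bounded `S₂`, for every weight `χ`,
`wsum χ (divV (κ u ↦ vertexOfK K N (S₂ κ u) ν y′)) = conjV (vertexOfK K N T′ ν y′) (diagK (z b ↦ ξ₁·χ (legSite ρ z b)))` — the column twin of TT12's «outer contact». -/
theorem wsum_divV_sliceVertex_eq_of_letter (hK : ∃ δ C : ℝ, 0 < δ ∧ 0 ≤ C ∧ Decays K C δ) {B₂ : ℝ} (hB : ∀ κ u κ' u' x z a b, |S₂ κ u κ' u' x z a b| ≤ B₂)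
    (χ : Site (d + 1) → ℝ) (ν : Fin (d + 1)) (y' : Site (d + 1)) :
    wsum χ (divV fun κ u => vertexOfK K N (S₂ κ u) ν y') = conjV (vertexOfK K N T' ν y') (diagK fun z b => ξ₁ * χ (legSite ρ z b)) :=
  wsum_divV_eq_conjV_of_letters_smul (fun w => divV_sliceVertex_eq_of_letter hL hK hB ν y' w) χ

include hL hT in
/-- [folklore] **(iii) THE DOUBLE GAUGE CORRECTION IS THE ITERATED CONTACT** (the gauge–gauge word): under `hL` and `hT`, absolutely summable `χ′`, bounded `S₂`, for every weight `χ`,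
`wsum χ (divV (κ u ↦ wsum χ′ (divV (S₂ κ u)))) = conjV (conjV 𝕄 (diagK (ξ₃·χ′∘legSite ρ))) (diagK (ξ₁·χ∘legSite ρ))` — `Λ₃^{ν,y′}` INSIDE, `Λ₁^{μ,y}` OUTSIDE, as in TT12. -/
theorem wsum_divV_wsum_divV_eq_of_letters {χ' : Site (d + 1) → ℝ} (hχ' : Summable fun u => |χ' u|) {B₂ : ℝ} (hB : ∀ κ u κ' u' x z a b, |S₂ κ u κ' u' x z a b| ≤ B₂)
    (χ : Site (d + 1) → ℝ) :
    wsum χ (divV fun κ u => wsum χ' (divV (S₂ κ u)))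
      = conjV (conjV 𝕄 (diagK fun z b => ξ₃ * χ' (legSite ρ z b))) (diagK fun z b => ξ₁ * χ (legSite ρ z b)) := by
  -- the divergence of the correction family, slot-commuted, under `hL` then `hT`
  have hdiv : ∀ w, divV (fun κ u => wsum χ' (divV (S₂ κ u))) w
      = conjV (conjV 𝕄 (diagK fun z b => ξ₃ * χ' (legSite ρ z b))) (diagK fun z b => ξ₁ * legInd ρ w z b) := by
    intro w
    rw [divV_wsum_divV_slice_eq hχ' hB w]
    have e : (fun w' => divV (fun κ' u' => divV (fun κ u => S₂ κ u κ' u') w) w')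
        = fun w' => conjV (conjV 𝕄 (diagK fun z b => ξ₃ * legInd ρ w' z b)) (diagK fun z b => ξ₁ * legInd ρ w z b) := by
      funext w'
      have e1 : (fun κ' u' => divV (fun κ u => S₂ κ u κ' u') w) = fun κ' u' => conjV (T' κ' u') (diagK fun z b => ξ₁ * legInd ρ w z b) := by
        funext κ' u'; rw [hL κ' u' w, smul_conjV_diagK']
      rw [e1, divV_conjV_diagK_fixed, hT w', smul_conjV_diagK']
    rw [e, wsum_conjV_conjV_diagK_legInd_inner]
  have e0 : (divV fun κ u => wsum χ' (divV (S₂ κ u)))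
      = fun w => conjV (conjV 𝕄 (diagK fun z b => ξ₃ * χ' (legSite ρ z b))) (diagK fun z b => ξ₁ * legInd ρ w z b) :=
    funext fun w => hdiv w
  rw [e0]
  exact wsum_conjV_diagK_legInd_smul _ χ ρ ξ₁

include hR in
/-- [folklore] **(iii′) THE SAME UNDER THE SECOND-SLOT PARTNER's LETTER** (leaf-03's reading «`hT` first order of `T`»; no summability at all): under `hR` and
`hT₂ : divV T w = ξ₃ • conjV 𝕄 (diagK (legInd ρ w))`, for ALL weights `χ`, `χ′`,
`wsum χ (divV (κ u ↦ wsum χ′ (divV (S₂ κ u)))) = conjV (conjV 𝕄 (diagK (ξ₃·χ∘legSite ρ))) (diagK (ξ₂·χ′∘legSite ρ))` — `Λ₃[χ]` INSIDE, `Λ₂[χ′]` OUTSIDE; equal to (iii)'s placement for one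
table and one lock by `conjV_conjV_diagK_comm`. -/
theorem wsum_divV_wsum_divV_eq_of_letters' (hT₂ : ∀ w, divV T w = ξ₃ • conjV 𝕄 (diagK (legInd ρ w))) (χ χ' : Site (d + 1) → ℝ) :
    wsum χ (divV fun κ u => wsum χ' (divV (S₂ κ u)))
      = conjV (conjV 𝕄 (diagK fun z b => ξ₃ * χ (legSite ρ z b))) (diagK fun z b => ξ₂ * χ' (legSite ρ z b)) := by
  have e : (fun κ u => wsum χ' (divV (S₂ κ u))) = fun κ u => conjV (T κ u) (diagK fun z b => ξ₂ * χ' (legSite ρ z b)) :=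
    funext fun κ => funext fun u => wsum_divV_slice_eq_of_letter hR χ' κ u
  have hdiv : (divV fun κ u => conjV (T κ u) (diagK fun z b => ξ₂ * χ' (legSite ρ z b)))
      = fun w => conjV (conjV 𝕄 (diagK fun z b => ξ₃ * legInd ρ w z b)) (diagK fun z b => ξ₂ * χ' (legSite ρ z b)) := by
    funext w; rw [divV_conjV_diagK_fixed, hT₂ w, smul_conjV_diagK']
  rw [e, hdiv]
  exact wsum_conjV_conjV_diagK_legInd_inner 𝕄 χ ρ ξ₃ _

end Letters

/-! ## §3 Assembled: the column-side second-order slot-shift letter -/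

section Assembled

variable {N : ℕ} (hN : 1 ≤ N) {r : Fin (d + 1) → ℕ} (hr : r ∈ box (d + 1) N) {K : MKer (d + 1) (Fib d)} (hK : ∃ δ C : ℝ, 0 < δ ∧ 0 ≤ C ∧ Decays K C δ)
  {S₂ : Fin (d + 1) → Site (d + 1) → Fin (d + 1) → Site (d + 1) → MKer (d + 1) (Fib d)} {C₂ δ₂ : ℝ} (hS₂ : LocStencil₂ S₂ C₂ δ₂) (hδ₂ : 0 < δ₂)
  (μ : Fin (d + 1)) (y : Site (d + 1)) (ν : Fin (d + 1)) (y' : Site (d + 1)) {M c : ℝ} (hM : 0 ≤ M) (hc : 0 < c)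
  (hKμ : ∀ κ u, |colH K N μ y κ u| ≤ M * Real.exp (-(c * supNorm (quo N u - y))))
  (hKν : ∀ κ u, |colH K N ν y' κ u| ≤ M * Real.exp (-(c * supNorm (quo N u - y'))))
  {T T' : Fin (d + 1) → Site (d + 1) → MKer (d + 1) (Fib d)} {𝕄 : MKer (d + 1) (Fib d)} {ρ : Site (d + 1)} {ξ₁ ξ₂ ξ₃ : ℝ}
  (hL : ∀ κ' u' w, divV (fun κ u => S₂ κ u κ' u') w = ξ₁ • conjV (T' κ' u') (diagK (legInd ρ w)))
  (hR : ∀ α x w', divV (S₂ α x) w' = ξ₂ • conjV (T α x) (diagK (legInd ρ w')))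
  (hT : ∀ w', divV T' w' = ξ₃ • conjV 𝕄 (diagK (legInd ρ w')))
include hN hr hS₂ hδ₂ hM hc hKν

include hR in
/-- [folklore] **(2) THE INNER SPLIT UNDER `hR`** (leaf-03's (2)): `vertexOfK K′ N (S₂ κ u) ν y′ = vertexOfK K N (S₂ κ u) ν y′ − conjV (T κ u) Λ₂^{ν,y′}`,
`Λ₂^{ν,y′} := diagK (z b ↦ ξ₂·χ′ (legSite ρ z b))`, `χ′ := bmGaugeAt (toSite r) (colH K N ν y′) N`. -/
theorem vertexOfK_coDress_slice_eq_of_letter (κ : Fin (d + 1)) (u : Site (d + 1)) :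
    vertexOfK (coDressKBmAt (toSite r) N K) N (S₂ κ u) ν y'
      = vertexOfK K N (S₂ κ u) ν y' - conjV (T κ u) (diagK fun z b => ξ₂ * bmGaugeAt (toSite r) (colH K N ν y') N (legSite ρ z b)) := by
  rw [vertexOfK_coDress_slice_eq_sub hN hr hS₂ hδ₂ ν y' hM hc hKν κ u, wsum_divV_slice_eq_of_letter hR]

include hK hKμ hL hR hT in
/-- [folklore] **(3) THE COLUMN-SIDE SECOND-ORDER SLOT-SHIFT LETTER** (leaf-03's (3), `conjV` form): with `χ := bmGaugeAt ρ (colH K N μ y) N`, `χ′ := bmGaugeAt ρ (colH K N ν y′) N`,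
`Λᵢ[χ] := diagK (z b ↦ ξᵢ·χ (legSite ρ z b))`, `V_T := vertexOfK K N T`,
`vertex2OfK K′ N S₂ μ y ν y′ = vertex2OfK K N S₂ μ y ν y′ − conjV (V_T μ y) Λ₂[χ′] − conjV (V_{T′} ν y′) Λ₁[χ] + conjV (conjV 𝕄 Λ₃[χ′]) Λ₁[χ]`
(§2's four-term split + §3b (i′)(ii)(iii)). -/
theorem vertex2OfK_coDressKBmAt_eq_of_letters :
    vertex2OfK (coDressKBmAt (toSite r) N K) N S₂ μ y ν y'
      = vertex2OfK K N S₂ μ y ν y'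
        - conjV (vertexOfK K N T μ y) (diagK fun z b => ξ₂ * bmGaugeAt (toSite r) (colH K N ν y') N (legSite ρ z b))
        - conjV (vertexOfK K N T' ν y') (diagK fun z b => ξ₁ * bmGaugeAt (toSite r) (colH K N μ y) N (legSite ρ z b))
        + conjV (conjV 𝕄 (diagK fun z b => ξ₃ * bmGaugeAt (toSite r) (colH K N ν y') N (legSite ρ z b)))
            (diagK fun z b => ξ₁ * bmGaugeAt (toSite r) (colH K N μ y) N (legSite ρ z b)) := by
  have hB : ∀ κ u κ' u' x z a b, |S₂ κ u κ' u' x z a b| ≤ C₂ := fun κ u κ' u' x z a b => abs_le_of_locStencil₂ hS₂ hδ₂.le κ u κ' u' x z a b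
  rw [vertex2OfK_coDressKBmAt_eq_four hN hr hK hS₂ hδ₂ μ y ν y' hM hc hKμ hKν, vertexOfK_wsum_divV_slice_eq_of_letter hR,
    wsum_divV_sliceVertex_eq_of_letter hL hK hB, wsum_divV_wsum_divV_eq_of_letters hL hT (summable_abs_bmGaugeAt hN hr K ν y' hM hc hKν) hB]

include hK hKμ hL hR in
/-- [folklore] **(3, primed) leaf-03's placement**: under `hL`, `hR` and the SECOND-slot partner's letter `hT₂ : divV T w = ξ₃ • conjV 𝕄 (diagK (legInd ρ w))`,
`vertex2OfK K′ N S₂ μ y ν y′ = vertex2OfK K N S₂ μ y ν y′ − conjV (V_T μ y) Λ₂[χ′] − conjV (V_{T′} ν y′) Λ₁[χ] + conjV (conjV 𝕄 Λ₃[χ]) Λ₂[χ′]`. -/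
theorem vertex2OfK_coDressKBmAt_eq_of_letters' (hT₂ : ∀ w, divV T w = ξ₃ • conjV 𝕄 (diagK (legInd ρ w))) :
    vertex2OfK (coDressKBmAt (toSite r) N K) N S₂ μ y ν y'
      = vertex2OfK K N S₂ μ y ν y'
        - conjV (vertexOfK K N T μ y) (diagK fun z b => ξ₂ * bmGaugeAt (toSite r) (colH K N ν y') N (legSite ρ z b))
        - conjV (vertexOfK K N T' ν y') (diagK fun z b => ξ₁ * bmGaugeAt (toSite r) (colH K N μ y) N (legSite ρ z b))
        + conjV (conjV 𝕄 (diagK fun z b => ξ₃ * bmGaugeAt (toSite r) (colH K N μ y) N (legSite ρ z b)))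
            (diagK fun z b => ξ₂ * bmGaugeAt (toSite r) (colH K N ν y') N (legSite ρ z b)) := by
  have hB : ∀ κ u κ' u' x z a b, |S₂ κ u κ' u' x z a b| ≤ C₂ := fun κ u κ' u' x z a b => abs_le_of_locStencil₂ hS₂ hδ₂.le κ u κ' u' x z a b
  rw [vertex2OfK_coDressKBmAt_eq_four hN hr hK hS₂ hδ₂ μ y ν y' hM hc hKμ hKν, vertexOfK_wsum_divV_slice_eq_of_letter hR,
    wsum_divV_sliceVertex_eq_of_letter hL hK hB, wsum_divV_wsum_divV_eq_of_letters' hR hT₂]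

include hK hKμ hL hR hT in
/-- [folklore] **(3′) THE SAME IN THE OWNER's ORIENTATION — LITERALLY `hessKer_columnGauge`'s `(Wmix + Wgg)` BRACKET**: with `Λᵢ^{μ,y} := diagK (z b ↦ ξᵢ·χ_{μ,y} (legSite ρ z b))`,
`V μ y := vertexOfK K N T μ y`, `V′ ν y′ := vertexOfK K N T′ ν y′`, `G ν y′ := Λ₃^{ν,y′}∘𝕄 − 𝕄∘Λ₃^{ν,y′}` (the `G` of `ColumnGaugeNativeFirstOrder` ∕ `DressedVertexSplit` read through
`ColumnGaugeGenerator`: `V^{bm} = V + (Λ∘𝕄 − 𝕄∘Λ)`),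
`vertex2OfK K′ N S₂ μ y ν y′ = vertex2OfK K N S₂ μ y ν y′ + (((Λ₂^{ν,y′}∘V μ y − V μ y∘Λ₂^{ν,y′}) + (Λ₁^{μ,y}∘V′ ν y′ − V′ ν y′∘Λ₁^{μ,y})) + (Λ₁^{μ,y}∘G ν y′ − G ν y′∘Λ₁^{μ,y}))`. -/
theorem vertex2OfK_coDressKBmAt_eq_add_Wmix_Wgg :
    vertex2OfK (coDressKBmAt (toSite r) N K) N S₂ μ y ν y'
      = vertex2OfK K N S₂ μ y ν y'
        + (((comp (diagK fun z b => ξ₂ * bmGaugeAt (toSite r) (colH K N ν y') N (legSite ρ z b)) (vertexOfK K N T μ y)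
              - comp (vertexOfK K N T μ y) (diagK fun z b => ξ₂ * bmGaugeAt (toSite r) (colH K N ν y') N (legSite ρ z b)))
            + (comp (diagK fun z b => ξ₁ * bmGaugeAt (toSite r) (colH K N μ y) N (legSite ρ z b)) (vertexOfK K N T' ν y')
              - comp (vertexOfK K N T' ν y') (diagK fun z b => ξ₁ * bmGaugeAt (toSite r) (colH K N μ y) N (legSite ρ z b))))
          + (comp (diagK fun z b => ξ₁ * bmGaugeAt (toSite r) (colH K N μ y) N (legSite ρ z b))
                (comp (diagK fun z b => ξ₃ * bmGaugeAt (toSite r) (colH K N ν y') N (legSite ρ z b)) 𝕄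
                  - comp 𝕄 (diagK fun z b => ξ₃ * bmGaugeAt (toSite r) (colH K N ν y') N (legSite ρ z b)))
            - comp (comp (diagK fun z b => ξ₃ * bmGaugeAt (toSite r) (colH K N ν y') N (legSite ρ z b)) 𝕄
                  - comp 𝕄 (diagK fun z b => ξ₃ * bmGaugeAt (toSite r) (colH K N ν y') N (legSite ρ z b)))
                (diagK fun z b => ξ₁ * bmGaugeAt (toSite r) (colH K N μ y) N (legSite ρ z b)))) := by
  rw [vertex2OfK_coDressKBmAt_eq_of_letters hN hr hK hS₂ hδ₂ μ y ν y' hM hc hKμ hKν hL hR hT, conjV_conjV_diagK_eq_comm_G]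
  unfold ChartConjugation.conjV
  abel

end Assembled

/-! ## §4 One table, one lock: the exact `(Wmix + Wgg)` bracket with ONE generator family -/

section OneTable

variable {N : ℕ} (hN : 1 ≤ N) {r : Fin (d + 1) → ℕ} (hr : r ∈ box (d + 1) N) {K : MKer (d + 1) (Fib d)} (hK : ∃ δ C : ℝ, 0 < δ ∧ 0 ≤ C ∧ Decays K C δ)
  {S₂ : Fin (d + 1) → Site (d + 1) → Fin (d + 1) → Site (d + 1) → MKer (d + 1) (Fib d)} {C₂ δ₂ : ℝ} (hS₂ : LocStencil₂ S₂ C₂ δ₂) (hδ₂ : 0 < δ₂)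
  (μ : Fin (d + 1)) (y : Site (d + 1)) (ν : Fin (d + 1)) (y' : Site (d + 1)) {M c : ℝ} (hM : 0 ≤ M) (hc : 0 < c)
  (hKμ : ∀ κ u, |colH K N μ y κ u| ≤ M * Real.exp (-(c * supNorm (quo N u - y))))
  (hKν : ∀ κ u, |colH K N ν y' κ u| ≤ M * Real.exp (-(c * supNorm (quo N u - y'))))
  {S : Fin (d + 1) → Site (d + 1) → MKer (d + 1) (Fib d)} {𝕄 : MKer (d + 1) (Fib d)} {ρ : Site (d + 1)} {ξ : ℝ}
  (hL : ∀ κ' u' w, divV (fun κ u => S₂ κ u κ' u') w = ξ • conjV (S κ' u') (diagK (legInd ρ w)))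
  (hR : ∀ α x w', divV (S₂ α x) w' = ξ • conjV (S α x) (diagK (legInd ρ w')))
  (hS : ∀ w', divV S w' = ξ • conjV 𝕄 (diagK (legInd ρ w')))
include hN hr hK hS₂ hδ₂ hM hc hKμ hKν hL hR hS

/-- [folklore] **THE COLUMN-SIDE SECOND-ORDER SLOT-SHIFT LETTER FOR A GENUINE SECOND-PARTIALS TABLE** (both slots' partner the first-partials family `S`, one lock `ξ`, the
first-order letter of `S` itself — the native spine's shape, `ColumnGaugeGenerator.divV_S0NAt_eq_smul_conjV`): with `Λ μ y := diagK (z b ↦ ξ·χ_{μ,y} (legSite ρ z b))`,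
`V := vertexOfK K N S`, `G ν y′ := Λ ν y′∘𝕄 − 𝕄∘Λ ν y′`,
`vertex2OfK K′ N S₂ μ y ν y′ = vertex2OfK K N S₂ μ y ν y′ + (((Λ ν y′∘V μ y − V μ y∘Λ ν y′) + (Λ μ y∘V ν y′ − V ν y′∘Λ μ y)) + (Λ μ y∘G ν y′ − G ν y′∘Λ μ y))` —
the `W ↦ W + (Wmix + Wgg)` of `ColumnGaugeInvariance.hessKer_columnGauge_of_relInv` for the `vertex2OfK` part of the second-order family, with the SAME `Λ` as the first order. -/
theorem vertex2OfK_coDressKBmAt_eq_add_Wmix_Wgg_one :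
    vertex2OfK (coDressKBmAt (toSite r) N K) N S₂ μ y ν y'
      = vertex2OfK K N S₂ μ y ν y'
        + (((comp (diagK fun z b => ξ * bmGaugeAt (toSite r) (colH K N ν y') N (legSite ρ z b)) (vertexOfK K N S μ y)
              - comp (vertexOfK K N S μ y) (diagK fun z b => ξ * bmGaugeAt (toSite r) (colH K N ν y') N (legSite ρ z b)))
            + (comp (diagK fun z b => ξ * bmGaugeAt (toSite r) (colH K N μ y) N (legSite ρ z b)) (vertexOfK K N S ν y')
              - comp (vertexOfK K N S ν y') (diagK fun z b => ξ * bmGaugeAt (toSite r) (colH K N μ y) N (legSite ρ z b))))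
          + (comp (diagK fun z b => ξ * bmGaugeAt (toSite r) (colH K N μ y) N (legSite ρ z b))
                (comp (diagK fun z b => ξ * bmGaugeAt (toSite r) (colH K N ν y') N (legSite ρ z b)) 𝕄
                  - comp 𝕄 (diagK fun z b => ξ * bmGaugeAt (toSite r) (colH K N ν y') N (legSite ρ z b)))
            - comp (comp (diagK fun z b => ξ * bmGaugeAt (toSite r) (colH K N ν y') N (legSite ρ z b)) 𝕄
                  - comp 𝕄 (diagK fun z b => ξ * bmGaugeAt (toSite r) (colH K N ν y') N (legSite ρ z b)))
                (diagK fun z b => ξ * bmGaugeAt (toSite r) (colH K N μ y) N (legSite ρ z b)))) :=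
  vertex2OfK_coDressKBmAt_eq_add_Wmix_Wgg hN hr hK hS₂ hδ₂ μ y ν y' hM hc hKμ hKν hL hR hS

end OneTable

end Summit.QuantumFields.BalabanUV.Beta.D1BFx.ColumnGaugeSecondOrder

end
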